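import Mathlib

/-!
# The discrete sine transform of the open chain: orthogonality and the three-term recurrence

Topic `MathematicalPhysics/QuantumLattice` (family `hubbard`; one-body input of Dirichlet-block
arguments). For `R ≥ 1` the vectors `s_J = (sin(π J U/(R+1)))_{U=1..R}`, `J = 1..R`, are the
eigenvectors of the adjacency matrix of the path on `R` vertices (free / Dirichlet boundary
conditions), with eigenvalues `2cos(πJ/(R+1))`. We prove the two elementary facts this rests on:

* `sum_range_cos_two_pi_mul_div_eq_zero` — a full-period cosine sum over a nontrivial frequency
  vanishes: `Σ_{u<N} cos(2π m u/N) = 0` for `0 < m < N` (geometric sum of `N`-th roots of unity);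
* `sum_Icc_sin_mul_sin` — **discrete sine orthogonality**:
  `Σ_{U=1}^{R} sin(πJU/(R+1)) sin(πJ'U/(R+1)) = ((R+1)/2)·[J = J']` for `1 ≤ J, J' ≤ R`
  (odd extension to the period `2R+2`, product-to-sum, and the previous item);
* `sin_chain_recurrence` — `sin(θ(U-1)) + sin(θ(U+1)) = 2cos θ · sin(θU)`, the eigen-equation of
  the path adjacency (the boundary values `sin 0 = sin(π J) = 0` make it Dirichlet).

References: G. Strang, *The discrete cosine transform*, SIAM Rev. 41 (1999) 135, §2 (DST-I and the
second-difference matrix with Dirichlet ends); folklore. No definition and no named fact is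
introduced. Mathlib: `geom_sum_eq`, `Complex.exp_nat_mul_two_pi_mul_I`, `Complex.exp_eq_one_iff`,
`Real.sin_add`, `Real.sin_sub`, `Real.cos_sub_cos`/product formulas.
-/

namespace Literature.MathematicalPhysics.QuantumLattice.DiscreteSine

open Finset Real

/-! ### Full-period cosine sums -/

/-- `Σ_{u<N} cos(2π m u/N) = Re Σ_{u<N} ω^u` with `ω = e^{2πi m/N}`. [folklore] -/
theorem sum_range_cos_eq_re_geom (N m : ℕ) :
    ∑ u ∈ range N, Real.cos (2 * π * m * u / N) =
      (∑ u ∈ range N, Complex.exp (2 * π * Complex.I * m / N) ^ u).re := by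
  rw [Complex.re_sum]
  refine Finset.sum_congr rfl fun u _ => ?_
  rw [← Complex.exp_nat_mul, show (u : ℂ) * (2 * π * Complex.I * m / N) =
      ((2 * π * m * u / N : ℝ) : ℂ) * Complex.I by push_cast; ring, Complex.exp_ofReal_mul_I_re]

/-- **A nontrivial full-period cosine sum vanishes**: `Σ_{u<N} cos(2π m u/N) = 0` for
`0 < m < N`. [folklore] -/
theorem sum_range_cos_two_pi_mul_div_eq_zero {N m : ℕ} (hm : 0 < m) (hmN : m < N) :
    ∑ u ∈ range N, Real.cos (2 * π * m * u / N) = 0 := by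
  have hN : 0 < N := lt_of_le_of_lt (Nat.zero_le _) hmN
  have hNc : (N : ℂ) ≠ 0 := by exact_mod_cast hN.ne'
  rw [sum_range_cos_eq_re_geom]
  set ω : ℂ := Complex.exp (2 * π * Complex.I * m / N) with hω
  have hωN : ω ^ N = 1 := by
    rw [hω, ← Complex.exp_nat_mul, show (N : ℂ) * (2 * π * Complex.I * m / N) =
      m * (2 * π * Complex.I) by field_simp]
    exact Complex.exp_nat_mul_two_pi_mul_I m
  have hω1 : ω ≠ 1 := by
    intro h
    rw [hω, Complex.exp_eq_one_iff] at h
    obtain ⟨n, hn⟩ := h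
    rw [div_eq_iff hNc] at hn
    have h2πI : (2 * π * Complex.I : ℂ) ≠ 0 := by simp [Real.pi_ne_zero, Complex.I_ne_zero]
    have h1 : (m : ℂ) = n * N := by
      calc (m : ℂ) = 2 * π * Complex.I * m / (2 * π * Complex.I) := by field_simp
        _ = n * (2 * π * Complex.I) * N / (2 * π * Complex.I) := by rw [hn]
        _ = n * N := by field_simp
    have h3 : (m : ℤ) = n * N := by exact_mod_cast h1
    have h4 : (N : ℤ) ∣ m := ⟨n, by rw [h3]; ring⟩
    have h5 : N ≤ m := Nat.le_of_dvd hm (by exact_mod_cast h4)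
    omega
  rw [geom_sum_eq hω1, hωN, sub_self, zero_div, Complex.zero_re]

/-- The trivial frequency: `Σ_{u<N} cos(0) = N`. [folklore] -/
theorem sum_range_cos_zero_mul (N : ℕ) :
    ∑ u ∈ range N, Real.cos (2 * π * (0 : ℕ) * u / N) = N := by
  simp

/-! ### Discrete sine orthogonality on the open chain -/

/-- Odd-extension bookkeeping: a function on `{0, …, 2R+1}` that vanishes at `0` and `R+1` and is
symmetric under `u ↦ 2R+2-u` sums to twice its sum over `{1, …, R}`. [folklore] -/
theorem sum_range_eq_two_mul_sum_Icc (R : ℕ) (f : ℕ → ℝ) (h0 : f 0 = 0) (hmid : f (R + 1) = 0)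
    (hsymm : ∀ u, 1 ≤ u → u ≤ R → f (2 * R + 2 - u) = f u) :
    ∑ u ∈ range (2 * R + 2), f u = 2 * ∑ u ∈ Icc 1 R, f u := by
  have hsplit : range (2 * R + 2) = {0} ∪ Icc 1 R ∪ {R + 1} ∪ Icc (R + 2) (2 * R + 1) := by
    ext u; simp only [mem_range, mem_union, mem_singleton, mem_Icc]; omega
  rw [hsplit, sum_union, sum_union, sum_union]
  · simp only [sum_singleton, h0, hmid, zero_add, add_zero]
    -- reflect the upper block onto the lower one
    have href : ∑ u ∈ Icc (R + 2) (2 * R + 1), f u = ∑ u ∈ Icc 1 R, f u := by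
      refine Finset.sum_nbij' (fun u => 2 * R + 2 - u) (fun u => 2 * R + 2 - u) ?_ ?_ ?_ ?_ ?_
      · intro u hu; simp only [mem_Icc] at hu ⊢; omega
      · intro u hu; simp only [mem_Icc] at hu ⊢; omega
      · intro u hu; simp only [mem_Icc] at hu; omega
      · intro u hu; simp only [mem_Icc] at hu; omega
      · intro u hu
        simp only [mem_Icc] at hu
        have h := hsymm (2 * R + 2 - u) (by omega) (by omega)
        rw [show 2 * R + 2 - (2 * R + 2 - u) = u by omega] at h
        exact h
    rw [href]; ring
  all_goals
    rw [Finset.disjoint_left]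
    intro a ha hb
    simp at ha hb
    omega

/-- The full-period sum of a product of two chain sines, by product-to-sum:
`Σ_{u<2R+2} sin(πJu/(R+1)) sin(πJ'u/(R+1)) = (R+1)·[J = J']` for `1 ≤ J, J' ≤ R`. [folklore] -/
theorem sum_range_sin_mul_sin (R : ℕ) {J J' : ℕ} (hJ : 1 ≤ J) (hJR : J ≤ R) (hJ' : 1 ≤ J')
    (hJ'R : J' ≤ R) :
    ∑ u ∈ range (2 * R + 2), Real.sin (π * J * u / (R + 1)) * Real.sin (π * J' * u / (R + 1)) =
      if J = J' then ((R : ℝ) + 1) else 0 := by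
  have hR1 : (0 : ℝ) < (R : ℝ) + 1 := by positivity
  -- product to sum: sin a sin b = (cos(a-b) - cos(a+b))/2
  have hpts : ∀ u : ℕ, Real.sin (π * J * u / (R + 1)) * Real.sin (π * J' * u / (R + 1)) =
      (Real.cos (π * J * u / (R + 1) - π * J' * u / (R + 1)) -
        Real.cos (π * J * u / (R + 1) + π * J' * u / (R + 1))) / 2 := fun u => by
    rw [Real.cos_sub, Real.cos_add]; ring
  simp_rw [hpts]
  rw [← Finset.sum_div, Finset.sum_sub_distrib]
  -- the sum frequency `J + J'` is nontrivial mod `2R+2`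
  have hplus : ∑ u ∈ range (2 * R + 2), Real.cos (π * J * u / (R + 1) + π * J' * u / (R + 1)) = 0 := by
    have h := sum_range_cos_two_pi_mul_div_eq_zero (N := 2 * R + 2) (m := J + J') (by omega) (by omega)
    rw [← h]
    refine Finset.sum_congr rfl fun u _ => ?_
    congr 1
    rw [← add_div, div_eq_div_iff (by positivity) (by positivity)]
    push_cast
    ring
  rw [hplus, sub_zero]
  by_cases hJJ : J = J'
  · subst hJJ
    rw [if_pos rfl]
    have : ∑ u ∈ range (2 * R + 2), Real.cos (π * J * u / (R + 1) - π * J * u / (R + 1)) =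
        2 * R + 2 := by
      simp only [sub_self, Real.cos_zero, sum_const, card_range, nsmul_eq_mul, mul_one]
      push_cast; ring
    rw [this]; ring
  · rw [if_neg hJJ]
    -- the difference frequency `|J - J'|` is nontrivial mod `2R+2`
    rcases lt_or_gt_of_ne hJJ with hlt | hgt
    · have h := sum_range_cos_two_pi_mul_div_eq_zero (N := 2 * R + 2) (m := J' - J) (by omega)
        (by omega)
      have : ∑ u ∈ range (2 * R + 2), Real.cos (π * J * u / (R + 1) - π * J' * u / (R + 1)) = 0 := by
        rw [← h]
        refine Finset.sum_congr rfl fun u _ => ?_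
        rw [← Real.cos_neg]
        congr 1
        rw [← sub_div, ← neg_div, div_eq_div_iff (by positivity) (by positivity)]
        push_cast [Nat.cast_sub hlt.le]
        ring
      rw [this, zero_div]
    · have h := sum_range_cos_two_pi_mul_div_eq_zero (N := 2 * R + 2) (m := J - J') (by omega)
        (by omega)
      have : ∑ u ∈ range (2 * R + 2), Real.cos (π * J * u / (R + 1) - π * J' * u / (R + 1)) = 0 := by
        rw [← h]
        refine Finset.sum_congr rfl fun u _ => ?_
        congr 1
        rw [← sub_div, div_eq_div_iff (by positivity) (by positivity)]
        push_cast [Nat.cast_sub hgt.le]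
        ring
      rw [this, zero_div]

/-- **Discrete sine orthogonality** (DST-I):
`Σ_{U=1}^{R} sin(πJU/(R+1)) sin(πJ'U/(R+1)) = ((R+1)/2)·[J = J']` for `1 ≤ J, J' ≤ R`.
Strang, SIAM Rev. 41 (1999) 135, §2. [folklore] -/
theorem sum_Icc_sin_mul_sin (R : ℕ) {J J' : ℕ} (hJ : 1 ≤ J) (hJR : J ≤ R) (hJ' : 1 ≤ J')
    (hJ'R : J' ≤ R) :
    ∑ U ∈ Icc 1 R, Real.sin (π * J * U / (R + 1)) * Real.sin (π * J' * U / (R + 1)) =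
      if J = J' then ((R : ℝ) + 1) / 2 else 0 := by
  have hR1 : (0 : ℝ) < (R : ℝ) + 1 := by positivity
  have hfull := sum_range_sin_mul_sin R hJ hJR hJ' hJ'R
  have hvan : ∀ K : ℕ, Real.sin (π * K * ((R + 1 : ℕ) : ℝ) / (R + 1)) = 0 := fun K => by
    rw [show π * K * ((R + 1 : ℕ) : ℝ) / (R + 1) = (K : ℝ) * π by push_cast; field_simp]
    exact_mod_cast Real.sin_nat_mul_pi K
  have hrefl : ∀ K u : ℕ, 1 ≤ u → u ≤ R →
      Real.sin (π * K * ((2 * R + 2 - u : ℕ) : ℝ) / (R + 1)) = -Real.sin (π * K * u / (R + 1)) := by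
    intro K u hu huR
    rw [show π * K * ((2 * R + 2 - u : ℕ) : ℝ) / (R + 1) = -(π * K * u / (R + 1)) + (K : ℕ) * (2 * π) by
      push_cast [Nat.cast_sub (show u ≤ 2 * R + 2 by omega)]
      field_simp
      ring]
    rw [Real.sin_add_nat_mul_two_pi, Real.sin_neg]
  have h2 := sum_range_eq_two_mul_sum_Icc R
    (fun u : ℕ => Real.sin (π * J * u / (R + 1)) * Real.sin (π * J' * u / (R + 1)))
    (by simp) (by simp only [hvan, zero_mul])
    (fun u hu huR => by simp only [hrefl J u hu huR, hrefl J' u hu huR, neg_mul_neg])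
  rw [h2] at hfull
  split_ifs at hfull ⊢ with h
  · linarith
  · linarith

/-! ### The three-term recurrence -/

/-- **Eigen-equation of the path adjacency**: `sin(θ(U-1)) + sin(θ(U+1)) = 2cos θ · sin(θ U)`.
[folklore] -/
theorem sin_chain_recurrence (θ U : ℝ) :
    Real.sin (θ * (U - 1)) + Real.sin (θ * (U + 1)) = 2 * Real.cos θ * Real.sin (θ * U) := by
  rw [show θ * (U - 1) = θ * U - θ by ring, show θ * (U + 1) = θ * U + θ by ring, Real.sin_sub,
    Real.sin_add]
  ring

end Literature.MathematicalPhysics.QuantumLattice.DiscreteSine
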